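import Summits.MatrixMultiplication.OmegaCensus.STPPHamidouneRodsethThree
import Summits.MatrixMultiplication.OmegaCensus.STPPVosperSlackOneKillsZ61B
import Summits.MatrixMultiplication.OmegaCensus.STPPVosperSlackOneKillsZ61C
import Summits.MatrixMultiplication.OmegaCensus.STPPVosperSlackOneKillsB2Z61
import Summits.MatrixMultiplication.OmegaCensus.STPPVosperSlackOneKillsZ59
import Summits.MatrixMultiplication.OmegaCensus.STPPVosperSlackOneKillsB2Z59
import Literature.Combinatorics.Additive.HamidouneRodsethInverseTheorem

/-!
# ω-census (abelian STPP census): the Hamidoune–Rødseth inverse theorem DISCHARGED, and the Card-4 slack-1 kills made unconditional (kernel)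

HONEST FRAMING (pub-omega census; verbatim): lottery ticket; floor = certified bounds/negative ranges.
Census STRUCTURE (seat pub-omega-stpp-1 gen 31, 2026-08-28), family (b2).  The slack-1 Vosper laws of
`STPPVosperSlackOneLaw*.lean` (stpp-1 g30) kill fourteen residual patterns of `ℤ₆₁` / `ℤ₅₉` modulo the named
fact `CubeNB.HamidouneRodsethInverseTheorem` (the Hamidoune–Rødseth inverse theorem mod `p`, Acta Arith. 92
(2000) 251–262, as printed in `STPPVosperSlackOneSteps.lean`), restricted in `STPPVosperSlackOneLawCard*.lean`
to the two cardinalities actually used, `HamidouneRodsethCard 3` and `HamidouneRodsethCard 4`.  stpp-2 g24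
proved `HamidouneRodsethCard 3` (`HR3.hamidouneRodsethCard_three`, `STPPHamidouneRodsethThree.lean`).  THIS FILE
closes the rest:

* `hamidouneRodsethInverseTheorem_of_card_three` — the full named fact follows from its `|S| = 3` layer, by
  the Literature theorem `Literature.Combinatorics.Additive.HamidouneRodseth.hamidouneRodseth_of_card_three`
  (`Literature/Combinatorics/Additive/HamidouneRodsethInverseTheorem.lean`, stpp-1 g31: the paper's Lemmas 3–7,
  Lemma 8 Case III and the §5 induction, typed on top of mm-stpp-lit's `IsoperimetricMethod.lean` which
  proves the paper's Theorem 5 and Lemma 1), plus Vosper for the sub-critical case `|S + T| < |S| + |T|`;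
* `hamidouneRodsethInverseTheorem_holds : HamidouneRodsethInverseTheorem` — the named fact is now a THEOREM;
* `hamidouneRodsethCard_holds : 3 ≤ k → HamidouneRodsethCard k` — in particular Card 4;
* the seven slack-1 kills that needed Card 4 (or the full theorem), UNCONDITIONALLY (`…_kernel`):
  `ℤ₆₁`: `{(1,1,2),(2,3,3),(3,3,2),(3,4,2)}`, `{(2,2,4),(3,4,2)²}`, `{(2,4,4),(2,3,3)²}`-reading `224_432_432`,
  `{(1,1,2),(2,3,2),(4,2,3)²}`; `ℤ₅₉`: `{(1,1,1),(2,4,4),(3,3,3)}`, `{(2,2,3),(2,4,3)²}`, `{(2,3,3)²,(2,3,4)}`.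
  (The three `(3,3)` leaves of `ℤ₆₁` and the four of `ℤ₅₉` are already `HR3.…_kernel` in
  `STPPHamidouneRodsethThree*.lean`.)

So every 'kernel-mod-HR' row of OMEGA-TABLE NR258 is now a kernel theorem with standard axioms; nothing here is
progress on `ω` — each theorem EXCLUDES STPP patterns.

References: Y. O. Hamidoune, Ø. J. Rødseth, Acta Arith. 92 (2000) 251–262; O. Serra, G. Zémor, Integers 0
(2000) A10, Thm 3; A. G. Vosper, J. London Math. Soc. 31 (1956); M. B. Nathanson, GTM 165, Thm 2.7;
H. Cohn, R. Kleinberg, B. Szegedy, C. Umans, FOCS 2005 (arXiv:math/0511460), Def. 5.1.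
-/

open Finset
open scoped Pointwise

namespace Summit.MatrixMultiplication.OmegaCensus.CubeNB

open Literature.Computability.AlgebraicComplexity
open Literature.Combinatorics.Additive
open Literature.Combinatorics.Additive.HamidouneRodseth

/-! ## The named fact, discharged -/

/-- **The Hamidoune–Rødseth inverse theorem follows from its `|S| = 3` layer.**  `HamidouneRodsethCard 3`
(the printed theorem for three-element `S`) implies `HamidouneRodsethInverseTheorem` in full: for
`|S + T| = |S| + |T|` this is `hamidouneRodseth_of_card_three` (Hamidoune–Rødseth §§4–5 typed in
`Literature/Combinatorics/Additive/HamidouneRodseth*.lean`; the step `d ≠ 0` required there follows from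
`|S| = 3`), and for `|S + T| < |S| + |T|` Cauchy–Davenport and Vosper make `S`, `T` progressions with a
common difference. [cite: HamidouneRodseth2000, Theorem 3 (p. 252) and §5 (p. 261)]
[cite: Vosper1956, main theorem; Nathanson1996, Thm 2.7] -/
theorem hamidouneRodsethInverseTheorem_of_card_three (h3 : HamidouneRodsethCard 3) :
    HamidouneRodsethInverseTheorem := by
  intro p _ S T hS3 hT3 h7 hp4 hle
  have hp4' : #(S + T) + 4 ≤ p := by omega
  by_cases heq : #(S + T) = #S + #T
  · have h3' : ∀ A B : Finset (ZMod p), #A = 3 → 3 ≤ #B → 7 ≤ #(A + B) → #(A + B) = #A + #B →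
        #(A + B) + 4 ≤ p → ∃ e a b : ZMod p, e ≠ 0 ∧ A ⊆ apFinset a e (#A + 1) ∧ B ⊆ apFinset b e (#B + 1) := by
      intro A B hA hB h7AB hABeq hp4AB
      obtain ⟨d, a, b, ha, hb⟩ := h3 p A B hA hB h7AB (by omega) hABeq.le
      exact ⟨d, a, b, step_ne_zero_of_subset_apFinset ha (by omega), ha, hb⟩
    obtain ⟨e, a, b, -, ha, hb⟩ := hamidouneRodseth_of_card_three h3' hS3 hT3 h7 heq hp4'
    exact ⟨e, a, b, ha, hb⟩
  · have hlt : #(S + T) < #S + #T := lt_of_le_of_ne hle heq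
    have hne : S + T ≠ univ := HamidouneRodseth.ne_univ_of_card_lt (by omega)
    have hSne : S.Nonempty := card_pos.1 (by omega)
    have hTne : T.Nonempty := card_pos.1 (by omega)
    have hcd := Vosper.cauchy_davenport_of_ne_univ hSne hTne hne
    obtain ⟨d, -, ⟨s, hs⟩, ⟨t, ht⟩⟩ := vosper_inverse (A := S) (B := T) (by omega) (by omega) (by omega) (by omega)
    exact ⟨d, s, t, hs.le.trans (Isoperimetric.apFinset_mono s d (by omega)),
      ht.le.trans (Isoperimetric.apFinset_mono t d (by omega))⟩

/-- **`HamidouneRodsethInverseTheorem` HOLDS** — the named fact of `STPPVosperSlackOneSteps.lean` (Hamidoune–Rødseth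
2000 = Serra–Zémor 2000 Thm 3, as printed), DISCHARGED: its `|S| = 3` layer is `HR3.hamidouneRodsethCard_three`
(stpp-2 g24) and the rest is `hamidouneRodsethInverseTheorem_of_card_three`.
[cite: HamidouneRodseth2000, main theorem (§1, p. 252)] [cite: SerraZemor2000, Theorem 3 (p. 2)] -/
theorem hamidouneRodsethInverseTheorem_holds : HamidouneRodsethInverseTheorem :=
  hamidouneRodsethInverseTheorem_of_card_three HR3.hamidouneRodsethCard_three

/-- **`HamidouneRodsethCard k` HOLDS for every `k ≥ 3`** (in particular Card 4, the other cardinality used by the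
slack-1 laws). [cite: HamidouneRodseth2000, main theorem (§1, p. 252)] -/
theorem hamidouneRodsethCard_holds {k : ℕ} (hk : 3 ≤ k) : HamidouneRodsethCard k :=
  hamidouneRodsethCard_of_inverseTheorem hamidouneRodsethInverseTheorem_holds hk

/-! ## The Card-4 leaves of `ℤ₆₁`, unconditionally -/

/-- **`{(1,1,2),(2,3,3),(3,3,2),(3,4,2)}` has no STPP family in `ℤ₆₁`** — UNCONDITIONAL (was
`…_of_hamidouneRodseth` / `…_of_hrCard34`; OMEGA-TABLE NR258).
[cite: CohnKleinbergSzegedyUmans2005, Def. 5.1] [cite: HamidouneRodseth2000, main theorem (§1, p. 252)] -/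
theorem no_isSTPP_zmod61_112_233_332_342_kernel (A B C : Fin 4 → Finset (ZMod 61)) (hS : IsSTPP A B C)
    (hA : ∀ i, #(A i) = ![1, 2, 3, 3] i) (hB : ∀ i, #(B i) = ![1, 3, 3, 4] i) (hC : ∀ i, #(C i) = ![2, 3, 2, 2] i) :
    False :=
  no_isSTPP_zmod61_112_233_332_342_of_hamidouneRodseth hamidouneRodsethInverseTheorem_holds A B C hS hA hB hC

/-- **`{(2,2,4),(3,4,2),(3,4,2)}` (reading `A = (2,3,3)`, `B = (2,4,4)`, `C = (4,2,2)`) has no STPP family in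
`ℤ₆₁`** — UNCONDITIONAL (was `…_of_hamidouneRodseth` / `…_of_hrCard4`; OMEGA-TABLE NR258).
[cite: CohnKleinbergSzegedyUmans2005, Def. 5.1] [cite: HamidouneRodseth2000, main theorem (§1, p. 252)] -/
theorem no_isSTPP_zmod61_224_342_342_kernel (A B C : Fin 3 → Finset (ZMod 61)) (hS : IsSTPP A B C)
    (hA : ∀ i, #(A i) = ![2, 3, 3] i) (hB : ∀ i, #(B i) = ![2, 4, 4] i) (hC : ∀ i, #(C i) = ![4, 2, 2] i) : False :=
  no_isSTPP_zmod61_224_342_342_of_hamidouneRodseth hamidouneRodsethInverseTheorem_holds A B C hS hA hB hC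

/-- **The second role reading of `{(2,2,4),(3,4,2)²}` (`A = (2,4,4)`, `B = (2,3,3)`, `C = (4,2,2)`) has no STPP
family in `ℤ₆₁`** — UNCONDITIONAL (was `…_of_hamidouneRodseth` / `…_of_hrCard4`; OMEGA-TABLE NR258).
[cite: CohnKleinbergSzegedyUmans2005, Def. 5.1] [cite: HamidouneRodseth2000, main theorem (§1, p. 252)] -/
theorem no_isSTPP_zmod61_224_432_432_kernel (A B C : Fin 3 → Finset (ZMod 61)) (hS : IsSTPP A B C)
    (hA : ∀ i, #(A i) = ![2, 4, 4] i) (hB : ∀ i, #(B i) = ![2, 3, 3] i) (hC : ∀ i, #(C i) = ![4, 2, 2] i) : False :=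
  no_isSTPP_zmod61_224_432_432_of_hamidouneRodseth hamidouneRodsethInverseTheorem_holds A B C hS hA hB hC

/-- **`{(1,1,2),(2,3,2),(4,2,3),(4,2,3)}` has no STPP family in `ℤ₆₁`** — UNCONDITIONAL (was
`…_of_hamidouneRodseth` / `…_of_hrCard4`; OMEGA-TABLE NR258).
[cite: CohnKleinbergSzegedyUmans2005, Def. 5.1] [cite: HamidouneRodseth2000, main theorem (§1, p. 252)] -/
theorem no_isSTPP_zmod61_112_232_423_423_kernel (A B C : Fin 4 → Finset (ZMod 61)) (hS : IsSTPP A B C)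
    (hA : ∀ i, #(A i) = ![1, 2, 4, 4] i) (hB : ∀ i, #(B i) = ![1, 3, 2, 2] i) (hC : ∀ i, #(C i) = ![2, 2, 3, 3] i) :
    False :=
  no_isSTPP_zmod61_112_232_423_423_of_hamidouneRodseth hamidouneRodsethInverseTheorem_holds A B C hS hA hB hC

/-! ## The Card-4 leaves of `ℤ₅₉`, unconditionally -/

/-- **`{(1,1,1),(2,4,4),(3,3,3)}` has no STPP family in `ℤ₅₉`** — UNCONDITIONAL (was `…_of_hamidouneRodseth` /
`…_of_hrCard4`; OMEGA-TABLE NR258).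
[cite: CohnKleinbergSzegedyUmans2005, Def. 5.1] [cite: HamidouneRodseth2000, main theorem (§1, p. 252)] -/
theorem no_isSTPP_zmod59_111_244_333_kernel (A B C : Fin 3 → Finset (ZMod 59)) (hS : IsSTPP A B C)
    (hA : ∀ i, #(A i) = ![1, 2, 3] i) (hB : ∀ i, #(B i) = ![1, 4, 3] i) (hC : ∀ i, #(C i) = ![1, 4, 3] i) : False :=
  no_isSTPP_zmod59_111_244_333_of_hamidouneRodseth hamidouneRodsethInverseTheorem_holds A B C hS hA hB hC

/-- **`{(2,2,3),(2,4,3),(2,4,3)}` has no STPP family in `ℤ₅₉`** — UNCONDITIONAL (was `…_of_hamidouneRodseth` /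
`…_of_hrCard4`; OMEGA-TABLE NR258).
[cite: CohnKleinbergSzegedyUmans2005, Def. 5.1] [cite: HamidouneRodseth2000, main theorem (§1, p. 252)] -/
theorem no_isSTPP_zmod59_223_243_243_kernel (A B C : Fin 3 → Finset (ZMod 59)) (hS : IsSTPP A B C)
    (hA : ∀ i, #(A i) = ![2, 2, 2] i) (hB : ∀ i, #(B i) = ![2, 4, 4] i) (hC : ∀ i, #(C i) = ![3, 3, 3] i) : False :=
  no_isSTPP_zmod59_223_243_243_of_hamidouneRodseth hamidouneRodsethInverseTheorem_holds A B C hS hA hB hC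

/-- **`{(2,3,3),(2,3,3),(2,3,4)}` has no STPP family in `ℤ₅₉`** — UNCONDITIONAL (was `…_of_hamidouneRodseth` /
`…_of_hrCard4`; OMEGA-TABLE NR258).
[cite: CohnKleinbergSzegedyUmans2005, Def. 5.1] [cite: HamidouneRodseth2000, main theorem (§1, p. 252)] -/
theorem no_isSTPP_zmod59_233_233_234_kernel (A B C : Fin 3 → Finset (ZMod 59)) (hS : IsSTPP A B C)
    (hA : ∀ i, #(A i) = ![2, 2, 2] i) (hB : ∀ i, #(B i) = ![3, 3, 3] i) (hC : ∀ i, #(C i) = ![3, 3, 4] i) : False :=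
  no_isSTPP_zmod59_233_233_234_of_hamidouneRodseth hamidouneRodsethInverseTheorem_holds A B C hS hA hB hC

end Summit.MatrixMultiplication.OmegaCensus.CubeNB
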